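import Summits.AnomalousDissipation.AnomalousDissipation.Theorems.RestMeanFloorTG.Negative.ShearSpinUp
import Literature.Analysis.FluidPDE.TorusWeakStrongUniquenessForced
import Literature.Analysis.FluidPDE.LerayHopfGalileanTorusMeans

/-!
# Every Leray–Hopf flow from rest under the shear force IS the laminar spin-up; the root's `∃ f`
# cannot be witnessed at a laminar force from rest (negative lane of `RestMeanFloorTG`, 24255)

Negative-lane proof file (theorems only; no `sorry`; no Theses statement asserted positively).

`ShearSpinUp` (this directory) exhibited ONE global Leray–Hopf solution from rest under the unit
shear force `shear 0 1 = (0, 0, cos 2πx₀)` — the Stokes spin-up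
`u_ν(t) = shear 0 ((4π²ν)⁻¹(1 − e^{−4π²νt}))` — with `⟨‖u_ν‖²⟩ ≥ 1/(256π⁴ν²)` and
`⟨ν‖∇u_ν‖²⟩ ≥ 1/(256π⁴ν)`, which refutes the `∀ u`-CEILING shapes at that force but says nothing
about OTHER Leray–Hopf solutions from rest. With the forced weak–strong uniqueness theorem on `T³`
(`Torus.IsGlobalLerayHopf.ae_eq_of_isClassicalNSSolutionOn_univ_forced`, Serrin–Masuda / Sohr 2001
Thm. V.1.5.1, landed in `Literature/Analysis/FluidPDE/TorusWeakStrongUniquenessForced.lean`) the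
spin-up is the ONLY one: every global Leray–Hopf solution from rest under `shear 0 1` coincides
with it a.e. at every positive time, hence has the same long-time means. Consequences recorded here:

* `ae_eq_spinUp_of_isGlobalLerayHopf_shear_rest` — uniqueness from rest at the shear force;
* `meanEnergy_eq_spinUp_…`, `meanDissipation_eq_spinUp_…` — the means of ANY such solution are the
  spin-up's; `le_meanEnergy_of_isGlobalLerayHopf_shear_rest` (`1/(256π⁴ν²) ≤ ⟨‖u‖²⟩`),
  `le_meanDissipation_of_isGlobalLerayHopf_shear_rest` (`1/(256π⁴ν) ≤ ⟨ν‖∇u‖²⟩`);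
* `restMeanFloor_forall_shape_shear` — the FLOOR holds at the shear force even in the `∀ u` form;
* `not_boundedEnergy_family_shear_rest` — there is NO vanishing-viscosity family of Leray–Hopf
  solutions from rest under `shear 0 1` with `ν`-uniformly bounded mean energy, whatever the choice
  of solutions; in particular
* `not_zerothLaw_shape_shear_rest` — the summit's shape `∃ ν_j → 0, u_j, …` (bounded mean energy AND
  dissipation floor) is FALSE when the force is pinned to `shear 0 1` and the data to rest: the
  root's `∃ f` must avoid every force whose (unique) rest-started flow is laminar with energy
  `~ ν⁻²` — the quantitative content of the «laminar obstruction» for the TG-pinned items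
  24255/24256/33849 is thus not an artefact of choosing a bad weak solution.
-/

noncomputable section
-- the mandated namespace `Summit.<Summit>.<Problem>.Theorems` repeats `AnomalousDissipation` (single-problem summit)
set_option linter.dupNamespace false

namespace Summit.AnomalousDissipation.AnomalousDissipation.Theorems.RestMeanFloorTG.Negative

open MeasureTheory Set Filter Topology UnitAddTorus
open scoped ENNReal NNReal InnerProductSpace ContDiff
open Literature.Analysis.FunctionSpaces Literature.Analysis.FunctionSpaces.Torus
open Literature.Analysis.FluidPDE Literature.Analysis.FluidPDE.Torus
open Summit.AnomalousDissipation.AnomalousDissipation.Theorems.TwohalfdNeg.Negative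

/-! ## 1. Uniqueness from rest at the shear force -/

/-- **Every global Leray–Hopf solution from rest under `shear 0 1` is the Stokes spin-up** (a.e. at
every `t > 0`): the spin-up is a global classical solution with the same force and datum `0`, and
classical solutions are unique in the Leray–Hopf class for the forced system on `T³`. [folklore] -/
theorem ae_eq_spinUp_of_isGlobalLerayHopf_shear_rest {ν : ℝ} (hν : 0 < ν)
    {u : ℝ → UnitAddTorus (Fin 3) → EuclideanSpace ℝ (Fin 3)}
    (hu : IsGlobalLerayHopf ν (fun _ => shear 0 1) 0 u) :
    ∀ t : ℝ, 0 < t → u t =ᵐ[volume]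
      shear 0 ((4 * Real.pi ^ 2 * ν)⁻¹ * (1 - Real.exp (-(4 * Real.pi ^ 2 * ν * t)))) := by
  set a : ℝ → ℝ := fun s => (4 * Real.pi ^ 2 * ν)⁻¹ * (1 - Real.exp (-(4 * Real.pi ^ 2 * ν * s))) with ha_def
  have ha : ContDiff ℝ ∞ a := contDiff_amp _ _
  have hcl := isClassicalNSSolutionOn_ampShear a ha ν
  have hb : ∀ t, deriv a t + 4 * Real.pi ^ 2 * ν * a t = 1 := fun t => by
    rw [ha_def, (hasDerivAt_amp (4 * Real.pi ^ 2 * ν) (4 * Real.pi ^ 2 * ν)⁻¹ t).deriv]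
    have hc : 4 * Real.pi ^ 2 * ν ≠ 0 := by positivity
    field_simp
    ring
  have hf : (fun t => shear 0 (deriv a t + 4 * Real.pi ^ 2 * ν * a t)) =
      fun _ => (shear 0 1 : UnitAddTorus (Fin 3) → EuclideanSpace ℝ (Fin 3)) := funext fun t => by rw [hb t]
  rw [hf] at hcl
  have ha0 : a 0 = 0 := by simp [ha_def]
  have h0 : (fun t => shear 0 (a t)) 0 = (0 : UnitAddTorus (Fin 3) → EuclideanSpace ℝ (Fin 3)) := by
    show shear 0 (a 0) = 0
    rw [ha0]
    funext x
    have h := norm_shear_le 0 0 x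
    rw [abs_zero] at h
    rw [Pi.zero_apply]
    exact norm_le_zero_iff.1 h
  have hu' : IsGlobalLerayHopf ν (fun _ => shear 0 1) ((fun t => shear 0 (a t)) 0) u := by
    rw [h0]
    exact hu
  intro t ht
  exact hu'.ae_eq_of_isClassicalNSSolutionOn_univ_forced hcl hν.le t ht

/-! ## 2. The long-time means of any solution from rest are the spin-up's -/

/-- The spectral `‖∇·‖₂²` only sees the a.e.-class (Fourier coefficients are integrals). [folklore] -/
private theorem eGradNormSq_congr_ae' {v w : UnitAddTorus (Fin 3) → EuclideanSpace ℝ (Fin 3)}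
    (h : v =ᵐ[volume] w) : eGradNormSq v = eGradNormSq w := by
  have h' : (EuclideanSpace.complexify ∘ v) =ᵐ[volume] (EuclideanSpace.complexify ∘ w) :=
    h.fun_comp EuclideanSpace.complexify
  unfold eGradNormSq eHomSobolevSeminorm
  simp_rw [mFourierCoeff_congr_ae h']

/-- **Mean energy of any Leray–Hopf solution from rest under `shear 0 1` = that of the spin-up.** [folklore] -/
theorem meanEnergy_eq_spinUp_of_isGlobalLerayHopf_shear_rest {ν : ℝ} (hν : 0 < ν)
    {u : ℝ → UnitAddTorus (Fin 3) → EuclideanSpace ℝ (Fin 3)}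
    (hu : IsGlobalLerayHopf ν (fun _ => shear 0 1) 0 u) :
    meanEnergy u = meanEnergy (fun t =>
      shear 0 ((4 * Real.pi ^ 2 * ν)⁻¹ * (1 - Real.exp (-(4 * Real.pi ^ 2 * ν * t))))) := by
  rw [meanEnergy_eq_longTimeAvgSup, meanEnergy_eq_longTimeAvgSup]
  refine longTimeAvgSup_congr_of_eqOn_Ioi fun t ht => integral_congr_ae ?_
  filter_upwards [ae_eq_spinUp_of_isGlobalLerayHopf_shear_rest hν hu t ht] with x hx
  rw [hx]

/-- **Mean dissipation of any Leray–Hopf solution from rest under `shear 0 1` = that of the spin-up.** [folklore] -/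
theorem meanDissipation_eq_spinUp_of_isGlobalLerayHopf_shear_rest {ν : ℝ} (hν : 0 < ν)
    {u : ℝ → UnitAddTorus (Fin 3) → EuclideanSpace ℝ (Fin 3)}
    (hu : IsGlobalLerayHopf ν (fun _ => shear 0 1) 0 u) :
    meanDissipation ν u = meanDissipation ν (fun t =>
      shear 0 ((4 * Real.pi ^ 2 * ν)⁻¹ * (1 - Real.exp (-(4 * Real.pi ^ 2 * ν * t))))) := by
  unfold meanDissipation
  refine longTimeAvgSup_congr_of_eqOn_Ioi fun t ht => ?_
  rw [eGradNormSq_congr_ae' (ae_eq_spinUp_of_isGlobalLerayHopf_shear_rest hν hu t ht)]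

/-- **Energy of EVERY Leray–Hopf solution from rest under `shear 0 1`**: `⟨‖u‖²⟩ ≥ 1/(256π⁴ν²)`. [folklore] -/
theorem le_meanEnergy_of_isGlobalLerayHopf_shear_rest {ν : ℝ} (hν : 0 < ν)
    {u : ℝ → UnitAddTorus (Fin 3) → EuclideanSpace ℝ (Fin 3)}
    (hu : IsGlobalLerayHopf ν (fun _ => shear 0 1) 0 u) :
    1 / (256 * Real.pi ^ 4 * ν ^ 2) ≤ meanEnergy u := by
  rw [meanEnergy_eq_spinUp_of_isGlobalLerayHopf_shear_rest hν hu]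
  have hc : 0 < 4 * Real.pi ^ 2 * ν := by positivity
  have hA : 0 ≤ (4 * Real.pi ^ 2 * ν)⁻¹ := inv_nonneg.2 hc.le
  refine le_trans (le_of_eq ?_) (meanEnergy_spinUp_ge hc hA)
  have hν0 : ν ≠ 0 := hν.ne'
  have hπ : Real.pi ≠ 0 := Real.pi_ne_zero
  field_simp
  ring

/-- **Dissipation of EVERY Leray–Hopf solution from rest under `shear 0 1`**: `⟨ν‖∇u‖²⟩ ≥ 1/(256π⁴ν)`. [folklore] -/
theorem le_meanDissipation_of_isGlobalLerayHopf_shear_rest {ν : ℝ} (hν : 0 < ν)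
    {u : ℝ → UnitAddTorus (Fin 3) → EuclideanSpace ℝ (Fin 3)}
    (hu : IsGlobalLerayHopf ν (fun _ => shear 0 1) 0 u) :
    1 / (256 * Real.pi ^ 4 * ν) ≤ meanDissipation ν u := by
  rw [meanDissipation_eq_spinUp_of_isGlobalLerayHopf_shear_rest hν hu]
  have hc : 0 < 4 * Real.pi ^ 2 * ν := by positivity
  have hA : 0 ≤ (4 * Real.pi ^ 2 * ν)⁻¹ := inv_nonneg.2 hc.le
  refine le_trans ?_ (meanDissipation_spinUp_ge hν.le hc hA)
  have hν0 : ν ≠ 0 := hν.ne'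
  have hπ : Real.pi ≠ 0 := Real.pi_ne_zero
  have hπ1 : 1 ≤ 4 * Real.pi ^ 2 := by nlinarith [Real.pi_gt_three]
  have key : 64 * Real.pi ^ 2 * ν ≤ 256 * Real.pi ^ 4 * ν :=
    calc 64 * Real.pi ^ 2 * ν = 64 * Real.pi ^ 2 * ν * 1 := by ring
      _ ≤ 64 * Real.pi ^ 2 * ν * (4 * Real.pi ^ 2) := mul_le_mul_of_nonneg_left hπ1 (by positivity)
      _ = 256 * Real.pi ^ 4 * ν := by ring
  calc 1 / (256 * Real.pi ^ 4 * ν) ≤ 1 / (64 * Real.pi ^ 2 * ν) := one_div_le_one_div_of_le (by positivity) key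
    _ = ν * (2 * Real.pi ^ 2) * ((4 * Real.pi ^ 2 * ν)⁻¹) ^ 2 / 8 := by
        field_simp
        ring

/-! ## 3. Consequences for the TG-pinned shapes, read at the shear force -/

/-- **The FLOOR shape holds at the shear force in the `∀ u` form**: with `ε = 1/(256π⁴)`, `ν₁ = 1`,
EVERY global Leray–Hopf solution from rest under `shear 0 1` with `ν ∈ (0,1)` has `⟨ν‖∇u‖²⟩ ≥ ε`
(strengthens `restMeanFloor_shape_shear`, which produced one such solution). [folklore] -/
theorem restMeanFloor_forall_shape_shear :
    ∃ ε ν₁ : ℝ, 0 < ε ∧ 0 < ν₁ ∧ ∀ ν : ℝ, 0 < ν → ν < ν₁ →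
      ∀ u : ℝ → UnitAddTorus (Fin 3) → EuclideanSpace ℝ (Fin 3),
        IsGlobalLerayHopf ν (fun _ => shear 0 1) 0 u → ε ≤ meanDissipation ν u := by
  refine ⟨1 / (256 * Real.pi ^ 4), 1, by positivity, one_pos, fun ν hν hν1 u hu => ?_⟩
  refine le_trans ?_ (le_meanDissipation_of_isGlobalLerayHopf_shear_rest hν hu)
  rw [div_le_div_iff_of_pos_left one_pos (by positivity) (by positivity)]
  calc 256 * Real.pi ^ 4 * ν ≤ 256 * Real.pi ^ 4 * 1 := mul_le_mul_of_nonneg_left hν1.le (by positivity)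
    _ = 256 * Real.pi ^ 4 := mul_one _

/-- **No vanishing-viscosity family from rest under the shear force has bounded mean energy**, for ANY
choice of the Leray–Hopf solutions `u_j` (uniqueness: each `u_j` is the spin-up, `⟨‖u_j‖²⟩ ≥ 1/(256π⁴ν_j²) → ∞`).
[folklore] -/
theorem not_boundedEnergy_family_shear_rest :
    ¬ ∃ (ν : ℕ → ℝ) (u : ℕ → ℝ → UnitAddTorus (Fin 3) → EuclideanSpace ℝ (Fin 3)),
        (∀ j, 0 < ν j) ∧ Tendsto ν atTop (𝓝 0) ∧
        (∀ j, IsGlobalLerayHopf (ν j) (fun _ => shear 0 1) 0 (u j)) ∧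
        ∃ E : ℝ, ∀ j, meanEnergy (u j) ≤ E := by
  rintro ⟨ν, u, hν, hν0, hu, E, hE⟩
  -- a viscosity `ν j` with `256π⁴ ν_j² (|E|+1) < 1`
  have hE1 : 0 < |E| + 1 := by positivity
  set δ : ℝ := min 1 (1 / (256 * Real.pi ^ 4 * (|E| + 1))) with hδ
  have hδ0 : 0 < δ := lt_min one_pos (by positivity)
  have hev : ∀ᶠ j in atTop, ν j < δ := (tendsto_order.1 hν0).2 δ hδ0
  obtain ⟨j, hj⟩ := hev.exists
  have hνj := hν j
  have hνj1 : ν j < 1 := hj.trans_le (min_le_left _ _)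
  have hνjδ : ν j < 1 / (256 * Real.pi ^ 4 * (|E| + 1)) := hj.trans_le (min_le_right _ _)
  have hlow := le_meanEnergy_of_isGlobalLerayHopf_shear_rest hνj (hu j)
  have hEj := hE j
  -- `1/(256π⁴ν²) ≥ 1/(256π⁴ν) > |E| + 1 > E`
  have h1 : |E| + 1 < 1 / (256 * Real.pi ^ 4 * ν j) := by
    rw [lt_div_iff₀ (by positivity)]
    rw [lt_div_iff₀ (by positivity)] at hνjδ
    linarith
  have h2 : 1 / (256 * Real.pi ^ 4 * ν j) ≤ 1 / (256 * Real.pi ^ 4 * ν j ^ 2) := by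
    refine one_div_le_one_div_of_le (by positivity) ?_
    have : ν j ^ 2 ≤ ν j := by nlinarith
    exact mul_le_mul_of_nonneg_left this (by positivity)
  have h3 : E ≤ |E| := le_abs_self E
  linarith

/-- **The summit's shape is FALSE at (shear force, rest data)**: there is no sequence `ν_j → 0` of
positive viscosities with global Leray–Hopf solutions `u_j` from rest under `shear 0 1` having
`ν`-uniformly bounded mean energy and a positive dissipation floor — already the energy clause fails
for every admissible choice of `u_j` (`not_boundedEnergy_family_shear_rest`). The zeroth law's `∃ f`
cannot be witnessed by a laminar force from rest; no Theses statement is asserted or refuted here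
(the TG-pinned items concern `f_TG`). [folklore] -/
theorem not_zerothLaw_shape_shear_rest :
    ¬ ∃ (ν : ℕ → ℝ) (u : ℕ → ℝ → UnitAddTorus (Fin 3) → EuclideanSpace ℝ (Fin 3)),
        (∀ j, 0 < ν j) ∧ Tendsto ν atTop (𝓝 0) ∧
        (∀ j, IsGlobalLerayHopf (ν j) (fun _ => shear 0 1) 0 (u j)) ∧
        (∃ E : ℝ, ∀ j, meanEnergy (u j) ≤ E) ∧
        ∃ ε : ℝ, 0 < ε ∧ ∀ j, ε ≤ meanDissipation (ν j) (u j) := by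
  rintro ⟨ν, u, hν, hν0, hu, hE, -⟩
  exact not_boundedEnergy_family_shear_rest ⟨ν, u, hν, hν0, hu, hE⟩

end Summit.AnomalousDissipation.AnomalousDissipation.Theorems.RestMeanFloorTG.Negative

end
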